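import Summits.BirchSwinnertonDyer.Rank1Residual.Additive.KatoDescentStrictSelmerCount
import Summits.BirchSwinnertonDyer.Rank1Residual.Additive.QuadraticBranchOddStrictExactControlDischarge
import HarnessLib

set_option autoImplicit false

/-!
# Route `ErratumRoadFive`, crux 19715 `EulerHalfNotRamNoInertSetAtFive`, line `kato_Fframe` (r5.x), stub S1Λ
# `stub_katoLambdaLogBoundTamagawa` — HELPER R-D: the STRICT SELMER COUNT at a MULTIPLICATIVE prime `p`
# `v_p #Sel_str + v_p #W(ℚ_p)[p^∞] + a + 1 = v_p #Ш[p^∞] + v_p Tam(W) + v(log_ω P)`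

Seat `bsd-idea-9` (planner/ideator, g40), `--supports stmt-BirchSwinnertonDyer-19715` as HELPER (LEAD `bsd-line-er5-p1` g8
partition 2026-08-30T06:12:43Z: «R-D → bsd-idea-9»); W-79: no registration touched; theorems only (no `def`, no named fact,
no instance, no notation, no `sorry`).  This is Part 31b of cell `bsd-cm`
(`Rank1Residual/Additive/KatoDescentStrictSelmerCount.lean`, `finite_katoStrictSelmer_and_padicValNat_card_eq`, ADDITIVE `p`)
transported to a MULTIPLICATIVE `p`: the ONE use of additivity at `p` in that proof is the image of the logarithm
`log(E(ℚ_p)) = p^{t − v_p c_p} ℤ_p` (`LocalLog.range_padicLog_baseChange_of_addv`); at a multiplicative `p` the image is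
`p^{1 + t − v_p c_p} ℤ_p` (`LocalLog.range_padicLog_baseChange_of_mult`: `#Ẽ_ns(𝔽_p) = p ∓ 1` is a `p`-unit), so the same
Poitou–Tate bookkeeping gives the identity with `e = 1 + t − v_p c_p`, i.e. with an extra `+ 1` on the left.

* §1 `finite_katoStrictSelmer_and_padicValNat_card_eq_of_mult_of_relIndex` — the INTERFACE form, reduction-type-free OFF `p`:
  the (R1-d) package of Part 30 (`S_Σ` characterised by membership, `Sel_{p^∞} ≤ S_Σ`, `[S_Σ : Sel_{p^∞}] ≠ 0`,
  `[S_Σ : Sel_{p^∞}] · p^a = ∏_{ℓ∈Σ} p^{v_p c_ℓ}`) enters AS HYPOTHESES, so that the theorem serves unchanged once (R1-d) is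
  available with MULTIPLICATIVE places in `Σ` (residual R-C of the line memo `Lines/kato_Fframe_r5_S1Lambda_level0.md` §2);
* §2 `finite_katoStrictSelmer_and_padicValNat_card_eq_of_mult` — ON THE ROWS available today: `Σ` = the bad places `≠ p`, all
  ADDITIVE (Part 30 as it stands), `p` multiplicative: `Sel_str` is FINITE and
  **`v_p #Sel_str + v_p #W(ℚ_{v_p})[p^∞] + a + 1 = v_p #Ш[p^∞] + v_p Tam(W) + v(log_ω P)`**.

HONEST LABEL: helper theorems; no stub or item is closed; nothing is registered; S1Λ is NOT proved here (its other inputs —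
F1′, H2Xʳ, the `A`-line identity L3′, and (R1-d) at multiplicative `ℓ ≠ p` — are separate); Kato's Main Conjecture is not
touched; BSD is proved for no curve.
References: [Kato2004Asterisque] §14.1 (p. 235), (14.9.3) (p. 240), (14.14.2) (p. 243), Prop. 14.16, 14.18 (p. 244);
[GreenbergLNM1716] §2–§3; [SilvermanAEC2009] IV.6.4, VII.6.1, VII.6.3, Exercise 3.5; [BlochKato1990] Ex. 3.11.
-/

noncomputable section

open scoped Classical NumberField ContRepresentation

open WeierstrassCurve Field IsDedekindDomain NumberField CategoryTheory Literature.NumberTheory.EllipticCurves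
  Literature.NumberTheory.EllipticCurves.Kato2004 Literature.NumberTheory.GaloisRepresentations
  Literature.NumberTheory.GaloisRepresentations.DiscreteGaloisModule
  Literature.NumberTheory.EllipticCurves.Kato2004.EulerSystemValues
open WeierstrassCurve (geomPoints geomTorsion geomPrimaryTorsion galH1Primary kummerMapTorsion)
open Summit.BirchSwinnertonDyer.Rank1Residual.Additive.StrictSha Summit.BirchSwinnertonDyer.Rank1Residual.X12.O11
open Summit.BirchSwinnertonDyer.Rank1Residual.X11b.LocBridge Literature.NumberTheory.EllipticCurves.Rank1Residual
open Summit.BirchSwinnertonDyer.Rank1Residual.Additive Summit.BirchSwinnertonDyer.Rank1Residual.Additive.StrictCount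
open Summit.BirchSwinnertonDyer.Rank1Residual.Additive.GlobalKummer
  Summit.BirchSwinnertonDyer.BirchSwinnertonDyer.Theorems.CongruentShaFreeCutKatoKummerLogTorsion

set_option linter.dupNamespace false

namespace Summit.BirchSwinnertonDyer.BirchSwinnertonDyer.Theorems.ErratumRoadFiveKatoFframeStrictSelmerCountMult

variable (W : WeierstrassCurve ℚ) [W.IsElliptic] [W.IsGloballyMinimal] (p : ℕ) [hp : Fact p.Prime]
  [ContinuousSMul ℤ_[p] (W.tateModule p)]

/-! ## §1 The interface form: (R1-d) as hypotheses, `p` multiplicative -/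

omit [ContinuousSMul ℤ_[p] (W.tateModule p)] in
/-- **THE STRICT SELMER COUNT AT A MULTIPLICATIVE `p`, (R1-d) AS HYPOTHESES.**  `W/ℚ` globally minimal, `p` odd,
MULTIPLICATIVE reduction at `p` (`Mult W p`), `rank_ℤ W(ℚ) = 1` generated by `P` modulo torsion, `Ш(W/ℚ)[p^∞]` finite;
`Σ` (`= Q`) a finite set of places `≠ v_p` containing every bad `ℓ ≠ p` (ANY reduction types), `S_Σ ≤ H¹(ℚ, W[p^∞])` a
subgroup characterised by «`p^∞`-Selmer local kernel off `Σ`, unramified at `Σ`» with `Sel_{p^∞} ≤ S_Σ`,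
`[S_Σ : Sel_{p^∞}] ≠ 0` and `[S_Σ : Sel_{p^∞}] · p^a = ∏_{ℓ∈Σ} p^{v_p c_ℓ}` (the (R1-d) package — Part 30
`KummerUnramified.exists_relIndex_selmerGroup_eq_pow_and_mul_eq` delivers it when every `ℓ ∈ Σ` is additive; at
multiplicative `ℓ` it is residual R-C).  THEN `Sel_str = katoStrictSelmer W p {v_p}` is FINITE and
**`v_p #Sel_str + v_p #W(ℚ_{v_p})[p^∞] + a + 1 = v_p #Ш[p^∞] + v_p Tam(W) + v(log_ω P)`** (Part 31a §1 at `E = ℚ_{v_p}` with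
`λ = p^{−e} log_ω`, `e = 1 + t − v_p c_p`, `ñ = v(log_ω P) − e`; `Tam = (∏_{ℓ∈Σ} c_ℓ) · c_p`).
[cite: Kato2004Asterisque, §14.1 (p. 235), (14.9.3) (p. 240), Prop. 14.16 (p. 244)] [cite: GreenbergLNM1716, §2 (pp. 62–63)]
[cite: SilvermanAEC2009, IV.6.4, VII.6.1, VII.6.3] -/
theorem finite_katoStrictSelmer_and_padicValNat_card_eq_of_mult_of_relIndex (hodd : p ≠ 2) (hmult : Mult W p)
    (hrank : W.mordellWeilRank = 1) (hsha : Finite (AddCommGroup.primaryComponent W.sha p)) {P : W.toAffine.Point}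
    (hgen : ∀ R : W.toAffine.Point, ∃ n : ℤ, IsOfFinAddOrder (R - n • P))
    (Q : Finset (HeightOneSpectrum (𝓞 ℚ)))
    (hQp : ∀ v ∈ Q, ((Rat.HeightOneSpectrum.primesEquiv v : Nat.Primes) : ℕ) ≠ p)
    (hQbad : ∀ v : HeightOneSpectrum (𝓞 ℚ), v ∈ W.badPlaces (𝓞 ℚ) →
      ((Rat.HeightOneSpectrum.primesEquiv v : Nat.Primes) : ℕ) ≠ p → v ∈ Q)
    (a : ℕ) (S : AddSubgroup (W.galH1Primary p))
    (hS : ∀ y, y ∈ S ↔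
      (∀ v : HeightOneSpectrum (𝓞 ℚ), v ∉ Q → y ∈ selmerLocalKerPrimary W (v.adicCompletion ℚ) p) ∧
      (∀ w : InfinitePlace ℚ, y ∈ selmerLocalKerPrimary W w.Completion p) ∧
      (∀ v ∈ Q, galoisCohomology.localization (primaryGaloisModule W p) (Sum.inr v) 1 y ∈
        unramifiedSubgroup (GaloisRep.toLocal v (primaryGaloisModule W p)) 1))
    (hle : selmerGroupPInfty W p ≤ S) (hne : (selmerGroupPInfty W p).relIndex S ≠ 0)
    (hprod : (selmerGroupPInfty W p).relIndex S * p ^ a =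
      ∏ v ∈ Q, p ^ padicValNat p ((W.baseChange (v.adicCompletion ℚ)).localTamagawaNumber (v.adicCompletionIntegers ℚ))) :
    Finite (katoStrictSelmer W p {primePlace p}) ∧
      (padicValNat p (Nat.card (katoStrictSelmer W p {primePlace p})) : ℤ) +
          padicValNat p (Nat.card (AddCommGroup.primaryComponent
            (W.baseChange ((primePlace p).adicCompletion ℚ)).toAffine.Point p)) + a + 1 =
        padicValNat p (Nat.card (AddCommGroup.primaryComponent W.sha p)) + padicValNat p W.tamagawaProduct +
          (padicLogLocal W p (Affine.Point.map (W' := W.toAffine) (S := ℚ) (Algebra.ofId ℚ ℚ_[p]) P)).valuation := by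
  have hp' : p.Prime := hp.out
  haveI := hsha
  have hP : ¬ IsOfFinAddOrder P := ContraCount.not_isOfFinAddOrder_of_generates hrank hgen
  have hvpQ : primePlace p ∉ Q := fun h => hQp _ h (coe_primesEquiv_primePlace p)
  -- the local field `ℚ_{v_p}` and `ℚ_p`
  let ι : ℚ_[p] →ₐ[ℚ] (primePlace p).adicCompletion ℚ := padicToAdic p
  let ε : ((primePlace p).adicCompletion ℚ) →ₐ[ℚ] ℚ_[p] :=
    ((Padic.adicCompletionEquiv (R := 𝓞 ℚ) ⟨p, hp'⟩).symm.toAlgEquiv : ((primePlace p).adicCompletion ℚ) ≃ₐ[ℚ] ℚ_[p]).toAlgHom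
  have hει : ∀ y, ε (ι y) = y := fun y => (Padic.adicCompletionEquiv (R := 𝓞 ℚ) ⟨p, hp'⟩).symm_apply_apply y
  have hιε : ∀ z, ι (ε z) = z := fun z => (Padic.adicCompletionEquiv (R := 𝓞 ℚ) ⟨p, hp'⟩).apply_symm_apply z
  let mε : (W.baseChange ((primePlace p).adicCompletion ℚ)).toAffine.Point →+ (W.baseChange ℚ_[p]).toAffine.Point :=
    Affine.Point.map (W' := W.toAffine) (S := ℚ) ε
  let mι : (W.baseChange ℚ_[p]).toAffine.Point →+ (W.baseChange ((primePlace p).adicCompletion ℚ)).toAffine.Point :=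
    Affine.Point.map (W' := W.toAffine) (S := ℚ) ι
  have hmει : ∀ X, mε (mι X) = X := fun X => by
    change Affine.Point.map (W' := W.toAffine) (S := ℚ) ε (Affine.Point.map (W' := W.toAffine) (S := ℚ) ι X) = X
    rw [Affine.Point.map_map]
    exact point_map_eq_self_of_forall_apply_eq W (ε.comp ι) hει X
  have hmιε : ∀ X, mι (mε X) = X := fun X => by
    change Affine.Point.map (W' := W.toAffine) (S := ℚ) ι (Affine.Point.map (W' := W.toAffine) (S := ℚ) ε X) = X
    rw [Affine.Point.map_map]
    exact point_map_eq_self_of_forall_apply_eq W (ι.comp ε) hιε X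
  have hmε_inj : Function.Injective mε := Affine.Point.map_injective (W' := W.toAffine) ε
  -- `λ = p^{-e} log_ω` on `E(ℚ_p)`, `e = 1 + t − v_p c_p` (MULTIPLICATIVE `p`), and its transport `λ_v` to `E(ℚ_{v_p})`
  obtain ⟨lam, hlam0, hsurj, hlamlog⟩ :=
    exists_hom_padicInt_of_range_padicLog (W.baseChange ℚ_[p]) (LocalLog.range_padicLog_baseChange_of_mult W p hmult)
  let lamv : (W.baseChange ((primePlace p).adicCompletion ℚ)).toAffine.Point →+ ℤ_[p] := lam.comp mε
  have hlamv0 : ∀ X, lamv X = 0 ↔ IsOfFinAddOrder X := fun X =>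
    (hlam0 (mε X)).trans (hmε_inj.isOfFinAddOrder_iff (f := mε))
  have hsurjv : Function.Surjective lamv := fun z => by
    obtain ⟨Y, hY⟩ := hsurj z
    exact ⟨mι Y, by change lam (mε (mι Y)) = z; rw [hmει]; exact hY⟩
  have hlambv : ∀ z : ℤ_[p], ∃ Y, lamv Y = (p : ℤ_[p]) ^ 0 * z := fun z => by
    obtain ⟨Y, hY⟩ := hsurjv z
    exact ⟨Y, by rw [pow_zero, one_mul]; exact hY⟩
  -- the point `P` over `ℚ_{v_p}` and over `ℚ_p`
  set X₀ : (W.baseChange ((primePlace p).adicCompletion ℚ)).toAffine.Point :=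
    Affine.Point.baseChange (W' := W) ℚ ((primePlace p).adicCompletion ℚ) P with hX₀
  have hX₀ε : mε X₀ = Affine.Point.map (W' := W.toAffine) (S := ℚ) (Algebra.ofId ℚ ℚ_[p]) P :=
    Affine.Point.map_baseChange (W' := W.toAffine) ε P
  have hX₀fin : ¬ IsOfFinAddOrder X₀ := fun h =>
    hP ((Affine.Point.map_injective (W' := W.toAffine) (Algebra.ofId ℚ ((primePlace p).adicCompletion ℚ))).isOfFinAddOrder_iff
      (f := Affine.Point.baseChange (W' := W) ℚ ((primePlace p).adicCompletion ℚ)) |>.mp h)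
  have hX₀0 : lamv X₀ ≠ 0 := fun h => hX₀fin ((hlamv0 X₀).mp h)
  obtain ⟨hdivP, hndiv⟩ := modTorsion_level_of_surjective p lamv hlamv0 hsurjv hX₀0
  -- `ñ = v(log_ω P) − e`, `e = 1 + t − v_p c_p`
  have hñ : ((lamv X₀).valuation : ℤ) =
      (padicLogLocal W p (Affine.Point.map (W' := W.toAffine) (S := ℚ) (Algebra.ofId ℚ ℚ_[p]) P)).valuation -
        ((1 : ℤ) + (padicValNat p (Nat.card (AddCommGroup.torsion (W.baseChange ℚ_[p]).toAffine.Point)) : ℤ) -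
          padicValNat p ((W.baseChange ℚ_[p]).localTamagawaNumber ℤ_[p])) := by
    have h := valuation_eq_valuation_padicLog_sub (W.baseChange ℚ_[p]) lam hlamlog (Q := mε X₀) hX₀0
    change ((lam (mε X₀)).valuation : ℤ) = _
    rw [hX₀ε] at h ⊢
    rw [← padicLogLocal_eq_padicLog] at h
    exact h
  -- `#W(ℚ_{v_p})[p^∞] = p^t`
  have ht : Nat.card (AddCommGroup.primaryComponent (W.baseChange ((primePlace p).adicCompletion ℚ)).toAffine.Point p) =
      p ^ padicValNat p (Nat.card (AddCommGroup.torsion (W.baseChange ℚ_[p]).toAffine.Point)) := by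
    rw [natCard_primaryComponent_eq_of_inverse mε mι hmιε hmει p]
    exact LocalLog.natCard_primaryComponent_point_eq_pow (W.baseChange ℚ_[p])
  -- Part 31a §1 at `E = ℚ_{v_p}`, `S = S_Σ`
  have hSloc : S ≤ selmerLocalKerPrimary W ((primePlace p).adicCompletion ℚ) p := fun y hy => ((hS y).mp hy).1 (primePlace p) hvpQ
  have hgen' : ∀ R : W.toAffine.Point, ∃ (k : ℤ) (T : W.toAffine.Point), IsOfFinAddOrder T ∧ R = k • P + T := by
    intro R
    obtain ⟨n, hn⟩ := hgen R
    exact ⟨n, R - n • P, hn, by abel⟩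
  haveI : PerfectField ((primePlace p).adicCompletion ℚ) :=
    @PerfectField.ofCharZero _ _
      (charZero_of_injective_ringHom (algebraMap ℚ ((primePlace p).adicCompletion ℚ)).injective)
  have hcount : Nat.card ↥(S ⊓ selmerLocalKerPrimaryTorsion W ((primePlace p).adicCompletion ℚ) p) =
      p ^ (lamv X₀).valuation *
        ((W.selmerGroupPInfty p).relIndex S * Nat.card (AddCommGroup.primaryComponent W.sha p)) := by
    refine card_inf_strict_eq_pow_mul_relIndex_mul_card_sha_modTorsion W p ((primePlace p).adicCompletion ℚ) lamv hlamv0 hlambv S hSloc hle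
      (P := P) ?_ ?_ ?_ ?_
    · convert hP
    · intro R
      obtain ⟨k, T, hT, hR⟩ := hgen' R
      exact ⟨k, T, by convert hT, by convert hR⟩
    · obtain ⟨Q₁, T₁, hT₁, hQ₁⟩ := hdivP
      exact ⟨Q₁, T₁, hT₁, by convert hQ₁ using 2; exact hX₀.symm⟩
    · intro Q₁ T₁ hT₁ h
      exact hndiv Q₁ T₁ hT₁ (by convert h using 2; exact hX₀)
  replace hcount : Nat.card (katoStrictSelmer W p {primePlace p}) =
      p ^ (lamv X₀).valuation *
        ((W.selmerGroupPInfty p).relIndex S * Nat.card (AddCommGroup.primaryComponent W.sha p)) := by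
    rw [katoStrictSelmer_eq_inf_strict W p hodd Q hQp hQbad S hS]
    exact hcount
  -- finiteness
  have hcard0 : Nat.card (katoStrictSelmer W p {primePlace p}) ≠ 0 := by
    rw [hcount]
    exact mul_ne_zero (pow_ne_zero _ hp'.ne_zero) (mul_ne_zero hne (Nat.card_pos (α := _)).ne')
  have hfin : Finite (katoStrictSelmer W p {primePlace p}) := Nat.finite_of_card_ne_zero hcard0
  refine ⟨hfin, ?_⟩
  -- valuations
  have hrel0 : (W.selmerGroupPInfty p).relIndex S ≠ 0 := hne
  have hsha0 : Nat.card (AddCommGroup.primaryComponent W.sha p) ≠ 0 := (Nat.card_pos (α := _)).ne'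
  have hv1 : padicValNat p (Nat.card (katoStrictSelmer W p {primePlace p})) =
      (lamv X₀).valuation + (padicValNat p ((W.selmerGroupPInfty p).relIndex S) +
        padicValNat p (Nat.card (AddCommGroup.primaryComponent W.sha p))) := by
    rw [hcount, padicValNat.mul (pow_ne_zero _ hp'.ne_zero) (mul_ne_zero hrel0 hsha0), padicValNat.prime_pow,
      padicValNat.mul hrel0 hsha0]
  -- the (R1-d) product, in valuations
  have hv2 : padicValNat p ((W.selmerGroupPInfty p).relIndex S) + a =
      ∑ v ∈ Q, padicValNat p ((W.baseChange (v.adicCompletion ℚ)).localTamagawaNumber (v.adicCompletionIntegers ℚ)) := by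
    have h := congrArg (padicValNat p) hprod
    rw [padicValNat.mul hrel0 (pow_ne_zero _ hp'.ne_zero), padicValNat.prime_pow,
      Finset.prod_pow_eq_pow_sum, padicValNat.prime_pow] at h
    exact h
  -- Tamagawa
  have hc0 : ∀ v ∈ Q, (W.baseChange (v.adicCompletion ℚ)).localTamagawaNumber (v.adicCompletionIntegers ℚ) ≠ 0 :=
    fun v _ => W.localTamagawaNumber_baseChange_ne_zero v
  have hcp0 : (W.baseChange ℚ_[p]).localTamagawaNumber ℤ_[p] ≠ 0 :=
    localTamagawaNumber_padic_ne_zero_holds p (W.baseChange ℚ_[p])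
  have hv3 : padicValNat p W.tamagawaProduct =
      (∑ v ∈ Q, padicValNat p ((W.baseChange (v.adicCompletion ℚ)).localTamagawaNumber (v.adicCompletionIntegers ℚ))) +
        padicValNat p ((W.baseChange ℚ_[p]).localTamagawaNumber ℤ_[p]) := by
    rw [tamagawaProduct_eq_prod_mul_padic W p Q hQp hQbad, padicValNat.mul (Finset.prod_ne_zero_iff.mpr hc0) hcp0,
      LevelBridge.padicValNat_finset_prod' p Q _ hc0]
  rw [ht, padicValNat.prime_pow, hv1, hv3]
  have hv2' := congrArg (Nat.cast : ℕ → ℤ) hv2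
  simp only [Nat.cast_add] at hv2' ⊢
  linarith [hñ, hv2']

/-! ## §2 On the rows available today: `Σ` additive (Part 30), `p` multiplicative -/

/-- **THE STRICT SELMER COUNT ON THE RANK-ONE ROWS AT A MULTIPLICATIVE `p`.**  `W/ℚ` globally minimal, `p` odd, MULTIPLICATIVE
reduction at `p` (`Mult W p`), `rank_ℤ W(ℚ) = 1` generated by `P` modulo torsion, `Ш(W/ℚ)[p^∞]` finite, `p ∤ #W(ℚ)_tors`;
`x = κ_∞(P) ∈ H¹(ℚ, T_pW)` (`ofTop(red_{p^k} x) = κ_{p^k}(P)`) with `H¹(ℤ[1/p], T_pW) = ℤ_p ∙ (p^a • x)`; `Σ` (`= Q`) a finite set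
of ADDITIVE places `≠ v_p` containing every bad `ℓ ≠ p` (i.e. `p` is the ONLY multiplicative prime of `W`).  THEN
`Sel_str = katoStrictSelmer W p {v_p}` is FINITE and
**`v_p #Sel_str + v_p #W(ℚ_{v_p})[p^∞] + a + 1 = v_p #Ш[p^∞] + v_p Tam(W) + v(log_ω P)`** (§1 with Part 30's (R1-d) package
`KummerUnramified.exists_relIndex_selmerGroup_eq_pow_and_mul_eq`, the lattice exponent being well defined by
`StrictCount.eq_of_integralH1_eq_span_pow_smul`).  Part 31b's additive-`p` identity has no `+ 1`: the difference is
`v_p #Ẽ_ns(𝔽_p) = 1` (additive) versus `0` (multiplicative) in `log(E(ℚ_p)) = p^{1 + t − v_p c_p − v_p #Ẽ_ns(𝔽_p)} ℤ_p`.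
[cite: Kato2004Asterisque, §14.1 (p. 235), (14.9.3) (p. 240), Prop. 14.16 (p. 244)] [cite: GreenbergLNM1716, §2 (pp. 62–63)]
[cite: SilvermanAEC2009, IV.6.4, VII.6.1, VII.6.3 and Exercise 3.5] -/
theorem finite_katoStrictSelmer_and_padicValNat_card_eq_of_mult (hodd : p ≠ 2) (hmult : Mult W p) (hrank : W.mordellWeilRank = 1)
    (hsha : Finite (AddCommGroup.primaryComponent W.sha p)) (htors : ¬ p ∣ W.torsionOrder) {P : W.toAffine.Point}
    (hgen : ∀ R : W.toAffine.Point, ∃ n : ℤ, IsOfFinAddOrder (R - n • P)) {x : H1 (tateRep W p) ⊤}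
    (hx : ∀ j : ℕ,
      (ofTopSubgroup (W.torsionGaloisModule ((p : ℤ) ^ j)).toTopRep 1).hom (reduceH1Pk W p j ⊤ x) =
        kummerMapTorsion W ((p : ℤ) ^ j) (zsmul_pow_surjective W p j) P)
    (Q : Finset (HeightOneSpectrum (𝓞 ℚ)))
    (hQp : ∀ v ∈ Q, ((Rat.HeightOneSpectrum.primesEquiv v : Nat.Primes) : ℕ) ≠ p)
    (hQadd : ∀ v ∈ Q, W.HasAdditiveReductionAt v)
    (hQbad : ∀ v : HeightOneSpectrum (𝓞 ℚ), v ∈ W.badPlaces (𝓞 ℚ) →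
      ((Rat.HeightOneSpectrum.primesEquiv v : Nat.Primes) : ℕ) ≠ p → v ∈ Q)
    {a : ℕ} (ha : integralH1 (tateRep W p) p ⊤ = ℤ_[p] ∙ (p ^ a • x)) :
    Finite (katoStrictSelmer W p {primePlace p}) ∧
      (padicValNat p (Nat.card (katoStrictSelmer W p {primePlace p})) : ℤ) +
          padicValNat p (Nat.card (AddCommGroup.primaryComponent
            (W.baseChange ((primePlace p).adicCompletion ℚ)).toAffine.Point p)) + a + 1 =
        padicValNat p (Nat.card (AddCommGroup.primaryComponent W.sha p)) + padicValNat p W.tamagawaProduct +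
          (padicLogLocal W p (Affine.Point.map (W' := W.toAffine) (S := ℚ) (Algebra.ofId ℚ ℚ_[p]) P)).valuation := by
  have hp' : p.Prime := hp.out
  haveI := hsha
  have hP : ¬ IsOfFinAddOrder P := ContraCount.not_isOfFinAddOrder_of_generates hrank hgen
  -- the auxiliary set `T = Σ ∪ {v_p}` of Part 30
  have hTp : ∀ v : HeightOneSpectrum (𝓞 ℚ), ((p : ℕ) : 𝓞 ℚ) ∈ v.asIdeal → v ∈ insert (primePlace p) Q := fun v hv =>
    Finset.mem_insert.mpr (Or.inl (BirchSwinnertonDyer.Theorems.KatoFiniteLevelCount.eq_primePlace_of_natCast_mem p hv))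
  have hTbad : ∀ v : HeightOneSpectrum (𝓞 ℚ), ¬ W.HasGoodReductionAt v → v ∈ insert (primePlace p) Q := by
    intro v hv
    rw [Finset.mem_insert]
    by_cases hvp : v = primePlace p
    · exact Or.inl hvp
    · right
      refine hQbad v ((W.mem_badPlaces_iff v).mpr hv) fun h => hvp ?_
      apply (Rat.HeightOneSpectrum.primesEquiv (R := 𝓞 ℚ)).injective
      rw [primesEquiv_primePlace]
      exact Subtype.ext h
  -- (R1-d), Part 30
  obtain ⟨a₀, hA₀, S, hS, hle, hne, hprod, -⟩ :=
    KummerUnramified.exists_relIndex_selmerGroup_eq_pow_and_mul_eq W p hodd hrank hsha htors hgen hx Q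
      (insert (primePlace p) Q) (Finset.subset_insert _ _) hQp hQadd hQbad hTp hTbad
  obtain rfl : a = a₀ := eq_of_integralH1_eq_span_pow_smul W p hP hx ha hA₀
  exact finite_katoStrictSelmer_and_padicValNat_card_eq_of_mult_of_relIndex W p hodd hmult hrank hsha hgen Q hQp hQbad a S hS
    hle hne hprod

end Summit.BirchSwinnertonDyer.BirchSwinnertonDyer.Theorems.ErratumRoadFiveKatoFframeStrictSelmerCountMult

end
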